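import Literature.Analysis.FluidPDE.QuasiSelfSimilarGeneratorMoves
import Literature.Analysis.FluidPDE.SmoothRampProfiles
import Mathlib.MeasureTheory.Measure.Haar.NormedSpace
import Mathlib.MeasureTheory.Group.Integral
import HarnessLib

/-!
# The transversal profile of the channel: moments on the fundamental square, a normalised profile

Topic `Literature/Analysis/FluidPDE`. Consumer-end brick for a discharge of `acm_compatible_blocks`
(`QuasiSelfSimilarCompatibleBlocks.lean`) through `acm_compatible_blocks_of_generator_moves[_peano]`
(`QuasiSelfSimilarGeneratorMoves.lean`): after that reduction the only integrals left are the two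
normalisations of the STRAIGHT channel at `t = 0` (`IsGeneratorBlock.zeroMean_zero`,
`IsGeneratorBlock.unitL2_zero`), whose datum on the fundamental square is a transversal profile
read across the channel, `Θ_S(0, z) = Gr((z₁ - 1/2)/κ)` (`PlanarRunElement.runScalar` at rest:
profile `Gr`, thickness scale `κ = Ξₓ`), together with the bound `|Θ| ≤ 10`. This file settles them.

* **Transfer for an arbitrary profile** `Gr` vanishing off `(-r, r)` (the hypothesis shape of the
  element files, `∀ q, Gr q ≠ 0 → |q| < r`), thickness `κ > 0` with `r κ ≤ 1/2` (the band stays in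
  the square): `∫_{[0,1)} Gr((y - 1/2)/κ) dy = κ ∫_ℝ Gr`, the same for squares, the same on the
  fundamental square `[0,1)²` (`setIntegral_Ico_profile[_sq]`, `setIntegral_unitCube_profile[_sq]`,
  and the `κ = 1` forms `…_one`), and the two normalisations of a scalar whose initial datum is such
  a band from `∫ Gr = 0`, `κ ∫ Gr² = 1` (`moments_of_scaled_profile`, `moments_of_profile`).
* **An explicit normalised profile.** From the plateau cut-off of `SmoothRampProfiles.lean`:
  `motherBump = plateau (-1/4) (1/4) (1/8)` (smooth, even, values in `[0,1]`, `= 1` on `[-1/6, 1/6]`,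
  `= 0` off `(-5/24, 5/24)`), the signed sum of four translates
  `motherProfile x = motherBump (x + 1/4) + motherBump (x - 1/4) - motherBump (x + 3/4) - motherBump (x - 3/4)`
  (even; ZERO MEAN by translation invariance; the translates have pairwise disjoint supports, so
  `|motherProfile| ≤ 1` and `∫ motherProfile² = 4 ∫ motherBump² ≥ 4/3`), its `L²`-normalisation
  `unitProfile` and the scaled family `channelProfile w x = (√w)⁻¹ · unitProfile (x / w)`:
  for `w > 0` smooth, even, vanishing off `(-w, w)`, `∫ channelProfile w = 0`,
  `∫ (channelProfile w)² = 1`, `|channelProfile w| ≤ (√w)⁻¹` (so `≤ 10` once `w ≥ 1/100`); hence the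
  straight tile `z ↦ channelProfile w (z₁ - 1/2)`, `0 < w ≤ 1/2`, has zero average and unit mass on
  `[0,1)²` (`setIntegral_unitCube_channelProfile`, `setIntegral_unitCube_channelProfile_sq`).

Folklore (elementary real analysis); the file states no named fact (net debt `0`).

## References

* G. Alberti, G. Crippa, A. L. Mazzucato, *Exponential self-similar mixing by incompressible
  flows*, J. Amer. Math. Soc. 32 (2019), 445–490, §8.3 (the profile across the channel)
  (arXiv:1605.02090).
* E. Bruè, C. De Lellis, Comm. Math. Phys. 400 (2023), §4.1 (b): `∫ Θ = 0`, `‖Θ(0)‖₂ = 1`.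
-/

noncomputable section

open MeasureTheory Set Filter Function
open scoped ContDiff Topology

namespace Literature.Analysis.FluidPDE

namespace QuasiSelfSimilar

open FunctionSpaces FunctionSpaces.Torus Gluing

/-! ## Transfer lemmas for an arbitrary profile -/

section Transfer

variable {Gr : ℝ → ℝ} {r κ : ℝ}

/-- A profile vanishing off `(-r, r)`, read at thickness `κ > 0` with `r κ ≤ 1/2` across the line
`y = 1/2`, vanishes off `[0, 1)`. [folklore] -/
theorem profile_comp_eq_zero_of_not_mem (hGr : ∀ q, Gr q ≠ 0 → |q| < r) (hκ : 0 < κ) (hrκ : r * κ ≤ 2⁻¹)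
    {y : ℝ} (hy : y ∉ Ico (0 : ℝ) 1) : Gr ((y - 2⁻¹) / κ) = 0 := by
  by_contra hne
  have h := hGr _ hne
  rw [abs_div, abs_of_pos hκ, div_lt_iff₀ hκ] at h
  have h' : |y - 2⁻¹| < 2⁻¹ := h.trans_le hrκ
  rw [abs_lt] at h'
  exact hy ⟨by linarith [h'.1], by linarith [h'.2]⟩

/-- The same at thickness `1`: a profile vanishing off `(-r, r)`, `r ≤ 1/2`, read across `y = 1/2`,
vanishes off `[0, 1)`. [folklore] -/
theorem profile_comp_eq_zero_of_not_mem_one (hGr : ∀ q, Gr q ≠ 0 → |q| < r) (hr : r ≤ 2⁻¹)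
    {y : ℝ} (hy : y ∉ Ico (0 : ℝ) 1) : Gr (y - 2⁻¹) = 0 := by
  by_contra hne
  have h' : |y - 2⁻¹| < 2⁻¹ := (hGr _ hne).trans_le hr
  rw [abs_lt] at h'
  exact hy ⟨by linarith [h'.1], by linarith [h'.2]⟩

/-- **Moment transfer, thickness `κ`**: `∫_{[0,1)} Gr((y - 1/2)/κ) dy = κ ∫ Gr`. [folklore] -/
theorem setIntegral_Ico_profile (hGr : ∀ q, Gr q ≠ 0 → |q| < r) (hκ : 0 < κ) (hrκ : r * κ ≤ 2⁻¹) :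
    ∫ y in Ico (0 : ℝ) 1, Gr ((y - 2⁻¹) / κ) = κ * ∫ q, Gr q := by
  rw [setIntegral_eq_integral_of_forall_compl_eq_zero
    (fun y hy => profile_comp_eq_zero_of_not_mem hGr hκ hrκ hy)]
  have h1 : ∫ y, Gr ((y - 2⁻¹) / κ) = ∫ y, Gr (y / κ) := integral_sub_right_eq_self (fun y => Gr (y / κ)) 2⁻¹
  rw [h1, Measure.integral_comp_div, abs_of_pos hκ, smul_eq_mul]

/-- **Moment transfer, thickness `1`**: `∫_{[0,1)} Gr(y - 1/2) dy = ∫ Gr`. [folklore] -/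
theorem setIntegral_Ico_profile_one (hGr : ∀ q, Gr q ≠ 0 → |q| < r) (hr : r ≤ 2⁻¹) :
    ∫ y in Ico (0 : ℝ) 1, Gr (y - 2⁻¹) = ∫ q, Gr q := by
  rw [setIntegral_eq_integral_of_forall_compl_eq_zero
    (fun y hy => profile_comp_eq_zero_of_not_mem_one hGr hr hy)]
  exact integral_sub_right_eq_self Gr 2⁻¹

/-- The support hypothesis passes to the square of the profile. [folklore] -/
theorem sq_profile_support (hGr : ∀ q, Gr q ≠ 0 → |q| < r) : ∀ q, Gr q ^ 2 ≠ 0 → |q| < r :=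
  fun q hq => hGr q ((pow_ne_zero_iff two_ne_zero).1 hq)

/-- **Second-moment transfer, thickness `κ`**: `∫_{[0,1)} Gr((y - 1/2)/κ)² dy = κ ∫ Gr²`. [folklore] -/
theorem setIntegral_Ico_profile_sq (hGr : ∀ q, Gr q ≠ 0 → |q| < r) (hκ : 0 < κ) (hrκ : r * κ ≤ 2⁻¹) :
    ∫ y in Ico (0 : ℝ) 1, Gr ((y - 2⁻¹) / κ) ^ 2 = κ * ∫ q, Gr q ^ 2 :=
  setIntegral_Ico_profile (Gr := fun q => Gr q ^ 2) (sq_profile_support hGr) hκ hrκ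

/-- **Second-moment transfer, thickness `1`**: `∫_{[0,1)} Gr(y - 1/2)² dy = ∫ Gr²`. [folklore] -/
theorem setIntegral_Ico_profile_sq_one (hGr : ∀ q, Gr q ≠ 0 → |q| < r) (hr : r ≤ 2⁻¹) :
    ∫ y in Ico (0 : ℝ) 1, Gr (y - 2⁻¹) ^ 2 = ∫ q, Gr q ^ 2 :=
  setIntegral_Ico_profile_one (Gr := fun q => Gr q ^ 2) (sq_profile_support hGr) hr

/-- **On the fundamental square, thickness `κ`**: `∫_{[0,1)²} Gr((z₁ - 1/2)/κ) dz = κ ∫ Gr`. [folklore] -/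
theorem setIntegral_unitCube_profile (hGr : ∀ q, Gr q ≠ 0 → |q| < r) (hκ : 0 < κ) (hrκ : r * κ ≤ 2⁻¹) :
    ∫ z in unitCube (Fin 2), Gr ((z 1 - 2⁻¹) / κ) = κ * ∫ q, Gr q :=
  (setIntegral_unitCube_comp_coord_one fun y => Gr ((y - 2⁻¹) / κ)).trans (setIntegral_Ico_profile hGr hκ hrκ)

/-- **On the fundamental square, thickness `κ`, squares**: `∫_{[0,1)²} Gr((z₁ - 1/2)/κ)² dz = κ ∫ Gr²`.
[folklore] -/
theorem setIntegral_unitCube_profile_sq (hGr : ∀ q, Gr q ≠ 0 → |q| < r) (hκ : 0 < κ) (hrκ : r * κ ≤ 2⁻¹) :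
    ∫ z in unitCube (Fin 2), Gr ((z 1 - 2⁻¹) / κ) ^ 2 = κ * ∫ q, Gr q ^ 2 :=
  (setIntegral_unitCube_comp_coord_one fun y => Gr ((y - 2⁻¹) / κ) ^ 2).trans
    (setIntegral_Ico_profile_sq hGr hκ hrκ)

/-- **On the fundamental square, thickness `1`**: `∫_{[0,1)²} Gr(z₁ - 1/2) dz = ∫ Gr`. [folklore] -/
theorem setIntegral_unitCube_profile_one (hGr : ∀ q, Gr q ≠ 0 → |q| < r) (hr : r ≤ 2⁻¹) :
    ∫ z in unitCube (Fin 2), Gr (z 1 - 2⁻¹) = ∫ q, Gr q :=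
  (setIntegral_unitCube_comp_coord_one fun y => Gr (y - 2⁻¹)).trans (setIntegral_Ico_profile_one hGr hr)

/-- **On the fundamental square, thickness `1`, squares**: `∫_{[0,1)²} Gr(z₁ - 1/2)² dz = ∫ Gr²`.
[folklore] -/
theorem setIntegral_unitCube_profile_sq_one (hGr : ∀ q, Gr q ≠ 0 → |q| < r) (hr : r ≤ 2⁻¹) :
    ∫ z in unitCube (Fin 2), Gr (z 1 - 2⁻¹) ^ 2 = ∫ q, Gr q ^ 2 :=
  (setIntegral_unitCube_comp_coord_one fun y => Gr (y - 2⁻¹) ^ 2).trans (setIntegral_Ico_profile_sq_one hGr hr)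

/-- **Normalisations of a straight channel from a scaled profile**: if on the fundamental square
`Θ(0, z) = Gr((z₁ - 1/2)/κ)` with `Gr` vanishing off `(-r, r)`, `κ > 0`, `r κ ≤ 1/2`, `∫ Gr = 0` and
`κ ∫ Gr² = 1`, then `Θ(0,·)` has zero average and unit mass on the square (the two clauses
`zeroMean_zero`, `unitL2_zero` of `IsGeneratorBlock`). [folklore] -/
theorem moments_of_scaled_profile {Θ : ℝ → EuclideanSpace ℝ (Fin 2) → ℝ}
    (hΘ : ∀ z ∈ unitCube (Fin 2), Θ 0 z = Gr ((z 1 - 2⁻¹) / κ)) (hGr : ∀ q, Gr q ≠ 0 → |q| < r)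
    (hκ : 0 < κ) (hrκ : r * κ ≤ 2⁻¹) (h0 : ∫ q, Gr q = 0) (h1 : κ * ∫ q, Gr q ^ 2 = 1) :
    (∫ z in unitCube (Fin 2), Θ 0 z = 0) ∧ ∫ z in unitCube (Fin 2), Θ 0 z ^ 2 = 1 := by
  constructor
  · rw [setIntegral_congr_fun measurableSet_unitCube hΘ, setIntegral_unitCube_profile hGr hκ hrκ, h0, mul_zero]
  · rw [setIntegral_congr_fun measurableSet_unitCube (fun z hz => by rw [hΘ z hz]),
      setIntegral_unitCube_profile_sq hGr hκ hrκ, h1]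

/-- **Normalisations of a straight channel from a profile** (thickness `1`): if on the fundamental
square `Θ(0, z) = Gr(z₁ - 1/2)` with `Gr` vanishing off `(-r, r)`, `r ≤ 1/2`, `∫ Gr = 0`, `∫ Gr² = 1`,
then `Θ(0,·)` has zero average and unit mass on the square. [folklore] -/
theorem moments_of_profile {Θ : ℝ → EuclideanSpace ℝ (Fin 2) → ℝ} (hΘ : ∀ z ∈ unitCube (Fin 2), Θ 0 z = Gr (z 1 - 2⁻¹))
    (hGr : ∀ q, Gr q ≠ 0 → |q| < r) (hr : r ≤ 2⁻¹) (h0 : ∫ q, Gr q = 0) (h1 : ∫ q, Gr q ^ 2 = 1) :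
    (∫ z in unitCube (Fin 2), Θ 0 z = 0) ∧ ∫ z in unitCube (Fin 2), Θ 0 z ^ 2 = 1 := by
  constructor
  · rw [setIntegral_congr_fun measurableSet_unitCube hΘ, setIntegral_unitCube_profile_one hGr hr, h0]
  · rw [setIntegral_congr_fun measurableSet_unitCube (fun z hz => by rw [hΘ z hz]),
      setIntegral_unitCube_profile_sq_one hGr hr, h1]

end Transfer

/-! ## The mother bump -/

/-- **Mother bump**: the plateau cut-off `plateau (-1/4) (1/4) (1/8)` — smooth, even, values in
`[0,1]`, `= 1` on `[-1/6, 1/6]`, `= 0` off `(-5/24, 5/24)`. [folklore] -/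
def motherBump (x : ℝ) : ℝ := plateau (-4⁻¹) 4⁻¹ 8⁻¹ x

/-- The mother bump is smooth. [folklore] -/
theorem motherBump_contDiff {n : ℕ∞} : ContDiff ℝ n motherBump := plateau_contDiff

/-- The mother bump is continuous. [folklore] -/
theorem motherBump_continuous : Continuous motherBump := (motherBump_contDiff (n := 0)).continuous

/-- The mother bump takes values in `[0,1]`. [folklore] -/
theorem motherBump_mem_Icc (x : ℝ) : motherBump x ∈ Icc (0 : ℝ) 1 := plateau_mem_Icc _ _ _ _

/-- The mother bump is nonnegative. [folklore] -/
theorem motherBump_nonneg (x : ℝ) : 0 ≤ motherBump x := (motherBump_mem_Icc x).1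

/-- The mother bump is at most `1`. [folklore] -/
theorem motherBump_le_one (x : ℝ) : motherBump x ≤ 1 := (motherBump_mem_Icc x).2

/-- The mother bump is `1` on `[-1/6, 1/6]`. [folklore] -/
theorem motherBump_eq_one {x : ℝ} (hx : |x| ≤ 6⁻¹) : motherBump x = 1 := by
  obtain ⟨h1, h2⟩ := abs_le.1 hx
  exact plateau_of_mem (by norm_num) (by linarith) (by linarith)

/-- The mother bump vanishes off `(-5/24, 5/24)`. [folklore] -/
theorem motherBump_eq_zero {x : ℝ} (hx : 5 / 24 ≤ |x|) : motherBump x = 0 := by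
  rcases le_abs'.1 hx with h | h
  · exact plateau_of_le_left (by norm_num) (by linarith)
  · exact plateau_of_ge_right (by norm_num) (by linarith)

/-- Where the mother bump does not vanish, `|x| < 5/24`. [folklore] -/
theorem abs_lt_of_motherBump_ne_zero {x : ℝ} (hx : motherBump x ≠ 0) : |x| < 5 / 24 := by
  by_contra h
  exact hx (motherBump_eq_zero (not_lt.1 h))

/-- The mother bump is even. [folklore] -/
theorem motherBump_neg (x : ℝ) : motherBump (-x) = motherBump x := by
  simp only [motherBump, plateau_apply]
  rw [mul_comm]
  congr 2 <;> ring

/-- The mother bump vanishes off the compact interval `[-1/4, 1/4]`. [folklore] -/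
theorem motherBump_eq_zero_of_not_mem {x : ℝ} (hx : x ∉ Icc (-4⁻¹ : ℝ) 4⁻¹) : motherBump x = 0 := by
  apply motherBump_eq_zero
  simp only [mem_Icc, not_and_or, not_le] at hx
  rcases hx with h | h
  · rw [abs_of_neg (by linarith)]; linarith
  · rw [abs_of_pos (by linarith)]; linarith

/-- The mother bump has compact support. [folklore] -/
theorem hasCompactSupport_motherBump : HasCompactSupport motherBump :=
  HasCompactSupport.intro isCompact_Icc fun _ hx => motherBump_eq_zero_of_not_mem hx

/-- The mother bump is integrable. [folklore] -/
theorem integrable_motherBump : Integrable motherBump :=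
  motherBump_continuous.integrable_of_hasCompactSupport hasCompactSupport_motherBump

/-- The square of the mother bump has compact support. [folklore] -/
theorem hasCompactSupport_motherBump_sq : HasCompactSupport fun x => motherBump x ^ 2 :=
  HasCompactSupport.intro isCompact_Icc fun _ hx => by rw [motherBump_eq_zero_of_not_mem hx]; simp

/-- The square of the mother bump is integrable. [folklore] -/
theorem integrable_motherBump_sq : Integrable fun x => motherBump x ^ 2 :=
  (motherBump_continuous.pow 2).integrable_of_hasCompactSupport hasCompactSupport_motherBump_sq

/-- **Lower bound for the mass of the mother bump**: `∫ motherBump² ≥ 1/3` (it is `1` on an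
interval of length `1/3`). [folklore] -/
theorem third_le_integral_motherBump_sq : 3⁻¹ ≤ ∫ x, motherBump x ^ 2 := by
  have h1 : ∫ x in Icc (-6⁻¹ : ℝ) 6⁻¹, motherBump x ^ 2 = 3⁻¹ := by
    rw [setIntegral_congr_fun measurableSet_Icc (g := fun _ => (1 : ℝ)) fun x hx => by
      simp only; rw [motherBump_eq_one (abs_le.2 ⟨hx.1, hx.2⟩), one_pow]]
    rw [setIntegral_const, Real.volume_real_Icc_of_le (by norm_num), smul_eq_mul]
    norm_num
  rw [← h1]
  exact setIntegral_le_integral integrable_motherBump_sq (Eventually.of_forall fun x => sq_nonneg _)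

/-- Translates of the mother bump by at least `1/2` apart have disjoint supports: the product
vanishes identically. [folklore] -/
theorem motherBump_mul_eq_zero {a b : ℝ} (hab : 2⁻¹ ≤ |a - b|) (x : ℝ) :
    motherBump (x + a) * motherBump (x + b) = 0 := by
  by_contra h
  obtain ⟨ha, hb⟩ := mul_ne_zero_iff.1 h
  have h1 := abs_lt_of_motherBump_ne_zero ha
  have h2 := abs_lt_of_motherBump_ne_zero hb
  have h3 : |a - b| ≤ |x + a| + |x + b| := by
    calc |a - b| = |(x + a) - (x + b)| := by ring_nf
      _ ≤ |x + a| + |x + b| := abs_sub _ _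
  linarith

/-! ## The mother profile -/

/-- **Mother profile**: `motherBump (x + 1/4) + motherBump (x - 1/4) - motherBump (x + 3/4) - motherBump (x - 3/4)`
— even, zero mean, supported in `(-23/24, 23/24)`. [folklore] -/
def motherProfile (x : ℝ) : ℝ :=
  motherBump (x + 4⁻¹) + motherBump (x + -4⁻¹) - motherBump (x + 3 / 4) - motherBump (x + -(3 / 4))

/-- The mother profile is smooth. [folklore] -/
theorem motherProfile_contDiff {n : ℕ∞} : ContDiff ℝ n motherProfile := by
  unfold motherProfile
  exact (((motherBump_contDiff.comp (contDiff_id.add contDiff_const)).add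
    (motherBump_contDiff.comp (contDiff_id.add contDiff_const))).sub
    (motherBump_contDiff.comp (contDiff_id.add contDiff_const))).sub
    (motherBump_contDiff.comp (contDiff_id.add contDiff_const))

/-- The mother profile is continuous. [folklore] -/
theorem motherProfile_continuous : Continuous motherProfile := (motherProfile_contDiff (n := 0)).continuous

/-- The mother profile is even. [folklore] -/
theorem motherProfile_neg (x : ℝ) : motherProfile (-x) = motherProfile x := by
  have e1 : motherBump (-x + 4⁻¹) = motherBump (x + -4⁻¹) := by
    rw [← motherBump_neg]; congr 1; ring
  have e2 : motherBump (-x + -4⁻¹) = motherBump (x + 4⁻¹) := by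
    rw [← motherBump_neg]; congr 1; ring
  have e3 : motherBump (-x + 3 / 4) = motherBump (x + -(3 / 4)) := by
    rw [← motherBump_neg]; congr 1; ring
  have e4 : motherBump (-x + -(3 / 4)) = motherBump (x + 3 / 4) := by
    rw [← motherBump_neg]; congr 1; ring
  simp only [motherProfile, e1, e2, e3, e4]
  ring

/-- Where the mother profile does not vanish, `|x| < 23/24`; in particular the mother profile
vanishes off `(-1, 1)`. [folklore] -/
theorem abs_lt_of_motherProfile_ne_zero {x : ℝ} (hx : motherProfile x ≠ 0) : |x| < 23 / 24 := by
  unfold motherProfile at hx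
  by_contra h
  have hx' : 23 / 24 ≤ |x| := not_lt.1 h
  have key : ∀ c : ℝ, |c| ≤ 3 / 4 → motherBump (x + c) = 0 := fun c hc =>
    motherBump_eq_zero (by
      have : |x| - |c| ≤ |x + c| := by
        have := abs_sub_abs_le_abs_sub x (-c)
        rwa [abs_neg, sub_neg_eq_add] at this
      linarith)
  rw [key _ (by norm_num [abs_of_pos]), key (-4⁻¹) (by norm_num [abs_of_neg]),
    key _ (by norm_num [abs_of_pos]), key (-(3 / 4)) (by norm_num [abs_of_neg])] at hx
  norm_num at hx

/-- Four reals in `[0,1]` with pairwise vanishing products: `|a + b - c - d| ≤ 1`. [folklore] -/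
theorem abs_signed_sum_le_one {a b c d : ℝ} (ha : a ∈ Icc (0 : ℝ) 1) (hb : b ∈ Icc (0 : ℝ) 1)
    (hc : c ∈ Icc (0 : ℝ) 1) (hd : d ∈ Icc (0 : ℝ) 1) (hab : a * b = 0) (hac : a * c = 0) (had : a * d = 0)
    (hbc : b * c = 0) (hbd : b * d = 0) (hcd : c * d = 0) : |a + b - c - d| ≤ 1 := by
  rw [abs_le]
  rcases eq_or_ne a 0 with rfl | ha0
  · rcases eq_or_ne b 0 with rfl | hb0
    · rcases eq_or_ne c 0 with rfl | hc0
      · constructor <;> linarith [hd.1, hd.2]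
      · have hd0 : d = 0 := (mul_eq_zero.1 hcd).resolve_left hc0
        subst hd0; constructor <;> linarith [hc.1, hc.2]
    · have hc0 : c = 0 := (mul_eq_zero.1 hbc).resolve_left hb0
      have hd0 : d = 0 := (mul_eq_zero.1 hbd).resolve_left hb0
      subst hc0 hd0; constructor <;> linarith [hb.1, hb.2]
  · have hb0 : b = 0 := (mul_eq_zero.1 hab).resolve_left ha0
    have hc0 : c = 0 := (mul_eq_zero.1 hac).resolve_left ha0
    have hd0 : d = 0 := (mul_eq_zero.1 had).resolve_left ha0
    subst hb0 hc0 hd0; constructor <;> linarith [ha.1, ha.2]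

/-- Four reals with pairwise vanishing products: `(a + b - c - d)² = a² + b² + c² + d²`. [folklore] -/
theorem signed_sum_sq {a b c d : ℝ} (hab : a * b = 0) (hac : a * c = 0) (had : a * d = 0)
    (hbc : b * c = 0) (hbd : b * d = 0) (hcd : c * d = 0) :
    (a + b - c - d) ^ 2 = a ^ 2 + b ^ 2 + c ^ 2 + d ^ 2 := by
  linear_combination (2 : ℝ) * hab - 2 * hac - 2 * had - 2 * hbc - 2 * hbd + 2 * hcd

/-- The pairwise products of the four translates in the mother profile vanish. [folklore] -/
theorem motherProfile_products (x : ℝ) :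
    motherBump (x + 4⁻¹) * motherBump (x + -4⁻¹) = 0 ∧ motherBump (x + 4⁻¹) * motherBump (x + 3 / 4) = 0 ∧
      motherBump (x + 4⁻¹) * motherBump (x + -(3 / 4)) = 0 ∧ motherBump (x + -4⁻¹) * motherBump (x + 3 / 4) = 0 ∧
      motherBump (x + -4⁻¹) * motherBump (x + -(3 / 4)) = 0 ∧ motherBump (x + 3 / 4) * motherBump (x + -(3 / 4)) = 0 :=
  ⟨motherBump_mul_eq_zero (by norm_num [abs_of_pos]) x, motherBump_mul_eq_zero (by norm_num [abs_of_neg]) x,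
    motherBump_mul_eq_zero (by norm_num [abs_of_pos]) x, motherBump_mul_eq_zero (by norm_num [abs_of_neg]) x,
    motherBump_mul_eq_zero (by norm_num [abs_of_pos]) x, motherBump_mul_eq_zero (by norm_num [abs_of_pos]) x⟩

/-- **The mother profile is bounded by `1`** (at every point at most one translate is nonzero).
[folklore] -/
theorem abs_motherProfile_le_one (x : ℝ) : |motherProfile x| ≤ 1 := by
  obtain ⟨h1, h2, h3, h4, h5, h6⟩ := motherProfile_products x
  exact abs_signed_sum_le_one (motherBump_mem_Icc _) (motherBump_mem_Icc _) (motherBump_mem_Icc _)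
    (motherBump_mem_Icc _) h1 h2 h3 h4 h5 h6

/-- **Pointwise square of the mother profile**: the sum of the squares of the four translates.
[folklore] -/
theorem motherProfile_sq (x : ℝ) : motherProfile x ^ 2 =
    motherBump (x + 4⁻¹) ^ 2 + motherBump (x + -4⁻¹) ^ 2 + motherBump (x + 3 / 4) ^ 2 + motherBump (x + -(3 / 4)) ^ 2 := by
  obtain ⟨h1, h2, h3, h4, h5, h6⟩ := motherProfile_products x
  exact signed_sum_sq h1 h2 h3 h4 h5 h6

/-- **The mother profile has zero mean** (translation invariance of the integral). [folklore] -/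
theorem integral_motherProfile : ∫ x, motherProfile x = 0 := by
  have i1 : Integrable fun x => motherBump (x + 4⁻¹) := integrable_motherBump.comp_add_right _
  have i2 : Integrable fun x => motherBump (x + -4⁻¹) := integrable_motherBump.comp_add_right _
  have i3 : Integrable fun x => motherBump (x + 3 / 4) := integrable_motherBump.comp_add_right _
  have i4 : Integrable fun x => motherBump (x + -(3 / 4)) := integrable_motherBump.comp_add_right _
  have i12 : Integrable fun x => motherBump (x + 4⁻¹) + motherBump (x + -4⁻¹) := i1.add i2
  have i123 : Integrable fun x => motherBump (x + 4⁻¹) + motherBump (x + -4⁻¹) - motherBump (x + 3 / 4) :=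
    i12.sub i3
  unfold motherProfile
  rw [integral_sub i123 i4, integral_sub i12 i3, integral_add i1 i2,
    integral_add_right_eq_self motherBump, integral_add_right_eq_self motherBump,
    integral_add_right_eq_self motherBump, integral_add_right_eq_self motherBump]
  ring

/-- **Mass of the mother profile**: `∫ motherProfile² = 4 ∫ motherBump²`. [folklore] -/
theorem integral_motherProfile_sq : ∫ x, motherProfile x ^ 2 = 4 * ∫ x, motherBump x ^ 2 := by
  have i1 : Integrable fun x => motherBump (x + 4⁻¹) ^ 2 := integrable_motherBump_sq.comp_add_right 4⁻¹
  have i2 : Integrable fun x => motherBump (x + -4⁻¹) ^ 2 := integrable_motherBump_sq.comp_add_right (-4⁻¹)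
  have i3 : Integrable fun x => motherBump (x + 3 / 4) ^ 2 := integrable_motherBump_sq.comp_add_right (3 / 4)
  have i4 : Integrable fun x => motherBump (x + -(3 / 4)) ^ 2 := integrable_motherBump_sq.comp_add_right (-(3 / 4))
  have i12 : Integrable fun x => motherBump (x + 4⁻¹) ^ 2 + motherBump (x + -4⁻¹) ^ 2 := i1.add i2
  have i123 : Integrable fun x =>
      motherBump (x + 4⁻¹) ^ 2 + motherBump (x + -4⁻¹) ^ 2 + motherBump (x + 3 / 4) ^ 2 := i12.add i3
  simp_rw [motherProfile_sq]
  rw [integral_add i123 i4, integral_add i12 i3, integral_add i1 i2,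
    integral_add_right_eq_self (fun x => motherBump x ^ 2), integral_add_right_eq_self (fun x => motherBump x ^ 2),
    integral_add_right_eq_self (fun x => motherBump x ^ 2), integral_add_right_eq_self (fun x => motherBump x ^ 2)]
  ring

/-- **Mass of the mother profile** `J = ∫ motherProfile²`. [folklore] -/
def motherMass : ℝ := ∫ x, motherProfile x ^ 2

/-- `J ≥ 4/3`. [folklore] -/
theorem four_thirds_le_motherMass : 4 / 3 ≤ motherMass := by
  rw [motherMass, integral_motherProfile_sq]
  linarith [third_le_integral_motherBump_sq]

/-- `J > 0`. [folklore] -/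
theorem motherMass_pos : 0 < motherMass := by linarith [four_thirds_le_motherMass]

/-- `1 ≤ √J`. [folklore] -/
theorem one_le_sqrt_motherMass : 1 ≤ Real.sqrt motherMass :=
  Real.one_le_sqrt.2 (by linarith [four_thirds_le_motherMass])

/-! ## The unit profile and the scaled channel profiles -/

/-- **Unit profile**: the `L²`-normalised mother profile. [folklore] -/
def unitProfile (x : ℝ) : ℝ := motherProfile x / Real.sqrt motherMass

/-- The unit profile is smooth. [folklore] -/
theorem unitProfile_contDiff {n : ℕ∞} : ContDiff ℝ n unitProfile :=
  motherProfile_contDiff.div_const _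

/-- The unit profile is even. [folklore] -/
theorem unitProfile_neg (x : ℝ) : unitProfile (-x) = unitProfile x := by
  rw [unitProfile, motherProfile_neg, unitProfile]

/-- Where the unit profile does not vanish, `|x| < 23/24 < 1`. [folklore] -/
theorem abs_lt_of_unitProfile_ne_zero {x : ℝ} (hx : unitProfile x ≠ 0) : |x| < 23 / 24 := by
  apply abs_lt_of_motherProfile_ne_zero
  intro h
  exact hx (by rw [unitProfile, h, zero_div])

/-- **The unit profile is bounded by `1`** (indeed by `(√J)⁻¹ ≤ √3/2`). [folklore] -/
theorem abs_unitProfile_le_one (x : ℝ) : |unitProfile x| ≤ 1 := by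
  rw [unitProfile, abs_div, abs_of_pos (Real.sqrt_pos.2 motherMass_pos)]
  calc |motherProfile x| / Real.sqrt motherMass ≤ |motherProfile x| / 1 :=
        div_le_div_of_nonneg_left (abs_nonneg _) one_pos one_le_sqrt_motherMass
    _ ≤ 1 := by rw [div_one]; exact abs_motherProfile_le_one x

/-- **The unit profile has zero mean.** [folklore] -/
theorem integral_unitProfile : ∫ x, unitProfile x = 0 := by
  simp_rw [unitProfile]
  rw [integral_div, integral_motherProfile, zero_div]

/-- **The unit profile has unit mass**: `∫ unitProfile² = 1`. [folklore] -/
theorem integral_unitProfile_sq : ∫ x, unitProfile x ^ 2 = 1 := by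
  simp_rw [unitProfile, div_pow, Real.sq_sqrt motherMass_pos.le]
  rw [integral_div, ← motherMass, div_self motherMass_pos.ne']

/-- **Channel profile of half-width `w`**: `(√w)⁻¹ · unitProfile (x / w)`. [folklore] -/
def channelProfile (w : ℝ) (x : ℝ) : ℝ := (Real.sqrt w)⁻¹ * unitProfile (x / w)

/-- Unfolding the channel profile. [folklore] -/
theorem channelProfile_apply (w x : ℝ) : channelProfile w x = (Real.sqrt w)⁻¹ * unitProfile (x / w) := rfl

/-- **The channel profile is smooth.** [folklore] -/
theorem channelProfile_contDiff (w : ℝ) {n : ℕ∞} : ContDiff ℝ n (channelProfile w) :=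
  contDiff_const.mul (unitProfile_contDiff.comp (contDiff_id.div_const w))

/-- **The channel profile is even.** [folklore] -/
theorem channelProfile_neg (w x : ℝ) : channelProfile w (-x) = channelProfile w x := by
  rw [channelProfile, neg_div, unitProfile_neg, channelProfile]

/-- **Support**: where the channel profile of half-width `w > 0` does not vanish, `|x| < w` (the
hypothesis shape `∀ q, Gr q ≠ 0 → |q| < r` of the element files, with `r = w`). [folklore] -/
theorem abs_lt_of_channelProfile_ne_zero {w : ℝ} (hw : 0 < w) {x : ℝ} (hx : channelProfile w x ≠ 0) : |x| < w := by
  have h : unitProfile (x / w) ≠ 0 := fun e => hx (by rw [channelProfile, e, mul_zero])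
  have h' := abs_lt_of_unitProfile_ne_zero h
  rw [abs_div, abs_of_pos hw, div_lt_iff₀ hw] at h'
  linarith

/-- The channel profile of half-width `w > 0` vanishes off `(-w, w)`. [folklore] -/
theorem channelProfile_eq_zero {w : ℝ} (hw : 0 < w) {x : ℝ} (hx : w ≤ |x|) : channelProfile w x = 0 := by
  by_contra h
  exact absurd (abs_lt_of_channelProfile_ne_zero hw h) (not_lt.2 hx)

/-- **Bound**: `|channelProfile w x| ≤ (√w)⁻¹`. [folklore] -/
theorem abs_channelProfile_le {w : ℝ} (hw : 0 < w) (x : ℝ) : |channelProfile w x| ≤ (Real.sqrt w)⁻¹ := by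
  rw [channelProfile, abs_mul, abs_of_pos (inv_pos.2 (Real.sqrt_pos.2 hw))]
  calc (Real.sqrt w)⁻¹ * |unitProfile (x / w)| ≤ (Real.sqrt w)⁻¹ * 1 :=
        mul_le_mul_of_nonneg_left (abs_unitProfile_le_one _) (inv_pos.2 (Real.sqrt_pos.2 hw)).le
    _ = (Real.sqrt w)⁻¹ := mul_one _

/-- **Bound by `10`** (the clause `abs_le` of `IsGeneratorBlock`) as soon as `w ≥ 1/100`. [folklore] -/
theorem abs_channelProfile_le_ten {w : ℝ} (hw : 100⁻¹ ≤ w) (x : ℝ) : |channelProfile w x| ≤ 10 := by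
  have hw0 : 0 < w := lt_of_lt_of_le (by norm_num) hw
  refine (abs_channelProfile_le hw0 x).trans ?_
  have h10 : (10 : ℝ)⁻¹ ≤ Real.sqrt w := by
    rw [show (10 : ℝ)⁻¹ = Real.sqrt 100⁻¹ by
      rw [show (100 : ℝ)⁻¹ = 10⁻¹ ^ 2 by norm_num, Real.sqrt_sq (by norm_num)]]
    exact Real.sqrt_le_sqrt hw
  calc (Real.sqrt w)⁻¹ ≤ (10⁻¹ : ℝ)⁻¹ := inv_anti₀ (by norm_num) h10
    _ = 10 := inv_inv _

/-- **The channel profile has zero mean.** [folklore] -/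
theorem integral_channelProfile (w : ℝ) : ∫ x, channelProfile w x = 0 := by
  simp_rw [channelProfile]
  rw [integral_const_mul, Measure.integral_comp_div, integral_unitProfile, smul_zero, mul_zero]

/-- **The channel profile has unit mass** (`w > 0`): `∫ (channelProfile w)² = 1`. [folklore] -/
theorem integral_channelProfile_sq {w : ℝ} (hw : 0 < w) : ∫ x, channelProfile w x ^ 2 = 1 := by
  simp_rw [channelProfile, mul_pow]
  rw [integral_const_mul, Measure.integral_comp_div (fun x => unitProfile x ^ 2), integral_unitProfile_sq,
    abs_of_pos hw, smul_eq_mul, mul_one, inv_pow, Real.sq_sqrt hw.le, inv_mul_cancel₀ hw.ne']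

/-! ## The straight tile -/

/-- **Zero average of the straight tile**: for `0 < w ≤ 1/2`,
`∫_{[0,1)²} channelProfile w (z₁ - 1/2) dz = 0`. [folklore] -/
theorem setIntegral_unitCube_channelProfile {w : ℝ} (hw : 0 < w) (hw' : w ≤ 2⁻¹) :
    ∫ z in unitCube (Fin 2), channelProfile w (z 1 - 2⁻¹) = 0 := by
  rw [setIntegral_unitCube_profile_one (fun q hq => abs_lt_of_channelProfile_ne_zero hw hq) hw',
    integral_channelProfile w]

/-- **Unit mass of the straight tile**: for `0 < w ≤ 1/2`,
`∫_{[0,1)²} channelProfile w (z₁ - 1/2)² dz = 1`. [folklore] -/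
theorem setIntegral_unitCube_channelProfile_sq {w : ℝ} (hw : 0 < w) (hw' : w ≤ 2⁻¹) :
    ∫ z in unitCube (Fin 2), channelProfile w (z 1 - 2⁻¹) ^ 2 = 1 := by
  rw [setIntegral_unitCube_profile_sq_one (fun q hq => abs_lt_of_channelProfile_ne_zero hw hq) hw',
    integral_channelProfile_sq hw]

/-- **Normalisations of a straight channel carrying the channel profile**: if on the fundamental
square `Θ(0, z) = channelProfile w (z₁ - 1/2)` with `0 < w ≤ 1/2`, then `Θ(0,·)` has zero average
and unit mass (the clauses `zeroMean_zero`, `unitL2_zero` of `IsGeneratorBlock`; with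
`IsGeneratorMove.toBlock`). [folklore] -/
theorem moments_of_channelProfile {Θ : ℝ → EuclideanSpace ℝ (Fin 2) → ℝ} {w : ℝ} (hw : 0 < w) (hw' : w ≤ 2⁻¹)
    (hΘ : ∀ z ∈ unitCube (Fin 2), Θ 0 z = channelProfile w (z 1 - 2⁻¹)) :
    (∫ z in unitCube (Fin 2), Θ 0 z = 0) ∧ ∫ z in unitCube (Fin 2), Θ 0 z ^ 2 = 1 :=
  moments_of_profile hΘ (fun _ hq => abs_lt_of_channelProfile_ne_zero hw hq) hw' (integral_channelProfile w)
    (integral_channelProfile_sq hw)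

/-- **Scaled reading**: at thickness `κ > 0` the profile `(√κ)⁻¹ · channelProfile r` read as
`Gr((z₁ - 1/2)/κ)`, `r κ ≤ 1/2`, also gives zero average and unit mass (for designs whose material
map has `Ξₓ = κ ≠ 1` at rest). [folklore] -/
theorem moments_of_channelProfile_scaled {Θ : ℝ → EuclideanSpace ℝ (Fin 2) → ℝ} {r κ : ℝ} (hr : 0 < r) (hκ : 0 < κ)
    (hrκ : r * κ ≤ 2⁻¹)
    (hΘ : ∀ z ∈ unitCube (Fin 2), Θ 0 z = (Real.sqrt κ)⁻¹ * channelProfile r ((z 1 - 2⁻¹) / κ)) :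
    (∫ z in unitCube (Fin 2), Θ 0 z = 0) ∧ ∫ z in unitCube (Fin 2), Θ 0 z ^ 2 = 1 := by
  refine moments_of_scaled_profile (Gr := fun q => (Real.sqrt κ)⁻¹ * channelProfile r q) hΘ
    (fun q hq => abs_lt_of_channelProfile_ne_zero hr fun e => hq (by rw [e, mul_zero])) hκ hrκ ?_ ?_
  · rw [integral_const_mul, integral_channelProfile r, mul_zero]
  · simp_rw [mul_pow]
    rw [integral_const_mul, integral_channelProfile_sq hr, mul_one, inv_pow, Real.sq_sqrt hκ.le,
      mul_inv_cancel₀ hκ.ne']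

end QuasiSelfSimilar

end Literature.Analysis.FluidPDE

end
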